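import Summits.Ventures.LatticeQCDFlow.Scaling.SimulatedTemperingLifted
import Summits.Ventures.LatticeQCDFlow.Scaling.LevelSchemeCutCeiling
import Summits.Ventures.LatticeQCDFlow.Scaling.LevelSchemeBallisticFloor

/-!
HONEST FRAMING: exact (Metropolis-corrected) sampling algorithms for lattice gauge theory; figures
of merit are autocorrelation/cost numbers at stated couplings and volumes; no continuum-physics
claim.

# SimulatedTemperingLiftedFloors — LIFTING DOES NOT RAISE THE FLOW ACROSS ANY CUT: THE LIFTED SAMPLER WITH TRANSPORT MAPS
# CROSSES THE CUT BETWEEN LEVELS `j, j+1` AT THE STATIONARY RATE `ov_e(j)/(2(K+1))`, `ov_e(j) = Σ_x min{μ_j(x), μ_{j+1}(e_j x)}`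
# THE MAP-ASSISTED OVERLAP (= `ov(j,j+1)` FOR `e = id`, EXACTLY THE METROPOLIS SAMPLER's RATE) — SO
# `d(n) ≤ ¼ ⇒ min{j+1, K−j} ≤ 2n·t·ov_e(j)` AND `3K ≤ 4n+1` HOLD FOR IT TOO (lean-2 GEN-20, ours)

Venture-side (OURS).  Cell `lqcd-flow` (pub-lqcd), unit `pub-lqcd-lean-2-g20`, 2026-08-25.  The instances announced in
`SimulatedTemperingLifted`: its lifted, non-reversible, exact sampler `P = t·L + (1−t)·stFinWithin (stLiftWithin M)`,
`L = stLiftLevel μ e` with transport maps `e k : S ≃ S`, on `Fin (K+1) × (S × Bool)` (target `stFinLaw (stLiftLaw μ)`), run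
through the "reversible or not" theorems of
`LevelSchemeCutCeiling` (per-cut mixing floor, stationarity only) and `LevelSchemeBallisticFloor` (one level per step).

* **`stLiftLevel_edgeMeasure_lowerLadder`** — `Q_π(L; levels ≤ j, levels > j) = ov_e(j)/(2(K+1))`: only `(j,x,↑)` crosses,
  with probability `min{1, μ_{j+1}(e_j x)/μ_j(x)}`; the direction marginal supplies the `½` that the Metropolis proposal
  supplied in `LevelSchemeCutCeiling.stFinLevel_edgeMeasure_lowerLadder` — for `e = id` the two rates COINCIDE.
* **`stLiftCut_mixing_floor`** — `μ_k`-stationary `M_k`, `0 ≤ t ≤ 1`, any cut `j`, `d(n) ≤ ¼` ⇒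
  `min{j+1, K−j} ≤ 2n·t·ov_e(j)`: one pair of adjacent couplings that overlaps poorly EVEN THROUGH ITS MAP throttles the
  lifted sampler exactly as a poorly overlapping pair throttles the reversible one (a perfect transport, `μ_{j+1}∘e_j = μ_j`,
  gives `ov_e(j) = 1` and the floor degenerates to the ballistic one).
* **`stLift_mixing_ballistic`** — `d(n) ≤ ¼ ⇒ 3K ≤ 4n + 1`.

Reading (no numerics implied): lifting removes the diffusive backtracking of the level (the order-`K²` law of
`AdjacentLevelSchemeDiffusiveCeiling` is for reversible moves only) but buys nothing against a bad pair of couplings and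
nothing below order `K`.  NOT CLAIMED: that the lifted sampler attains either floor; anything measured.  Literature grade
(cell rule): corollary file (KNOWN MECHANISM, NEW TYPING); nothing cited as a fact; no new bib keys.
-/

noncomputable section

open Finset Function
open Literature.Probability.MarkovChains

namespace Summit.Ventures.LatticeQCDFlow.Scaling

variable {S : Type*} [Fintype S] [DecidableEq S] {K : ℕ} {μ : Fin (K + 1) → S → ℝ}
  {M : Fin (K + 1) → Matrix S S ℝ} {t : ℝ}

/-- **The lifted move crosses the cut `j` at the stationary rate `ov(j,j+1)/(2(K+1))`** (`μ > 0`). [ours] -/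
theorem stLiftLevel_edgeMeasure_lowerLadder (hμ : ∀ k x, 0 < μ k x) (e : Fin (K + 1) → S ≃ S) (j : Fin K) :
    edgeMeasure (stFinLaw (stLiftLaw μ)) (stLiftLevel μ e) (lowerLadder (S × Bool) j) (lowerLadder (S × Bool) j)ᶜ
      = (∑ x, min (μ j.castSucc x) (μ j.succ (e j.castSucc x))) / (2 * (K + 1)) := by
  have hjs : ((j.succ : Fin (K + 1)) : ℕ) = (j : ℕ) + 1 := Fin.val_succ j
  have hjc : ((j.castSucc : Fin (K + 1)) : ℕ) = (j : ℕ) := Fin.val_castSucc j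
  have hup : stLiftNext j.castSucc true = j.succ := by
    apply Fin.ext; simp only [stLiftNext]; rw [dif_pos (by rw [hjc]; have := j.isLt; omega)]; simp
  -- the inner sum: from `p` at level `≤ j` only the advance of `(j, x, ↑)` leaves the lower part
  have hT : ∀ p ∈ lowerLadder (S × Bool) j, ∑ q ∈ (lowerLadder (S × Bool) j)ᶜ, stFinLaw (stLiftLaw μ) p * stLiftLevel μ e p q
      = if p.1 = j.castSucc ∧ p.2.2 = true then μ j.castSucc p.2.1 / 2 / (K + 1) * stLiftAcc μ e p else 0 := by
    intro p hp
    rw [mem_lowerLadder] at hp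
    have hflip : stLiftFlip p ∉ (lowerLadder (S × Bool) j)ᶜ := by
      rw [mem_compl_lowerLadder, not_lt]; exact hp
    by_cases hcross : p.1 = j.castSucc ∧ p.2.2 = true
    · rw [if_pos hcross]
      have hadv : (stLiftAdv e p).1 = j.succ := by unfold stLiftAdv; rw [hcross.2, hcross.1, hup]
      have hmem : stLiftAdv e p ∈ (lowerLadder (S × Bool) j)ᶜ := by rw [mem_compl_lowerLadder, hadv, hjs]; omega
      rw [Finset.sum_eq_single_of_mem (stLiftAdv e p) hmem (fun q hq hne => ?_)]
      · unfold stLiftLevel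
        rw [if_pos rfl, if_neg (stLiftAdv_ne_stLiftFlip e p)]
        have e : stFinLaw (stLiftLaw μ) p = μ j.castSucc p.2.1 / 2 / (K + 1) := by
          unfold stFinLaw stLiftLaw; rw [hcross.1]
        rw [e]; ring
      · rw [stLiftLevel_eq_zero hne (fun e => hflip (e ▸ hq)), mul_zero]
    · rw [if_neg hcross]
      refine sum_eq_zero fun q hq => ?_
      by_cases h1 : q = stLiftAdv e p
      · -- the advance stays at level `≤ j` unless `p = (j, ·, ↑)`
        exfalso
        rw [mem_compl_lowerLadder, h1] at hq
        unfold stLiftAdv at hq; simp only at hq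
        rcases stLiftNext_spec p.1 p.2.2 with ⟨hs, -, e⟩ | ⟨-, -, e⟩ | ⟨e, -⟩
        · exact hcross ⟨Fin.ext (by rw [hjc]; omega), hs⟩
        · omega
        · rw [e] at hq; omega
      · by_cases h2 : q = stLiftFlip p
        · exact absurd (h2 ▸ hq) hflip
        · rw [stLiftLevel_eq_zero h1 h2, mul_zero]
  have h0 : ∀ p ∈ (univ : Finset (Fin (K + 1) × (S × Bool))), p ∉ lowerLadder (S × Bool) j →
      (if p.1 = j.castSucc ∧ p.2.2 = true then μ j.castSucc p.2.1 / 2 / (K + 1) * stLiftAcc μ e p else 0) = 0 := by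
    intro p _ hp
    rw [mem_lowerLadder, not_le] at hp
    rw [if_neg]
    rintro ⟨e, -⟩
    rw [e, hjc] at hp
    omega
  unfold edgeMeasure
  rw [sum_congr rfl hT, Finset.sum_subset (subset_univ (lowerLadder (S × Bool) j)) h0, Fintype.sum_prod_type,
    Finset.sum_eq_single j.castSucc (fun l _ hl => sum_eq_zero fun a _ => if_neg (fun h => hl h.1))
      (fun h => absurd (mem_univ _) h)]
  simp only [true_and]
  rw [Fintype.sum_prod_type]
  simp_rw [Fintype.sum_bool, if_true, Bool.false_eq_true, if_false, add_zero]
  rw [Finset.sum_div]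
  refine sum_congr rfl fun x _ => ?_
  have hacc : stLiftAcc μ e (j.castSucc, (x, true)) = min 1 (μ j.succ (e j.castSucc x) / μ j.castSucc x) := by
    unfold stLiftAcc; simp only [stLiftMap]
    rw [hup, if_neg (fun e' => by have := congrArg Fin.val e'; rw [hjs, hjc] at this; omega)]
  rw [hacc, show μ j.castSucc x / 2 / (K + 1) * min 1 (μ j.succ (e j.castSucc x) / μ j.castSucc x)
      = μ j.castSucc x * min 1 (μ j.succ (e j.castSucc x) / μ j.castSucc x) / (2 * (K + 1)) by rw [div_div]; ring,
    mul_min_of_nonneg _ _ (hμ _ x).le, mul_one, mul_div_cancel₀ _ (hμ _ x).ne']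

section Floors

variable (hμ : ∀ k x, 0 < μ k x) (hμ1 : ∀ k, ∑ x, μ k x = 1) (hM : ∀ k, IsRowStochastic (M k)) (ht0 : 0 ≤ t)
  (ht1 : t ≤ 1) (e : Fin (K + 1) → S ≃ S)
include hμ hμ1 hM ht0 ht1

/-- **THE PER-CUT MIXING FLOOR OF THE LIFTED SAMPLER:** `μ_k`-stationary within-level updates, `0 ≤ t ≤ 1`, any cut `j`,
`d(n) ≤ ¼` ⇒ `min{j+1, K−j} ≤ 2n·t·ov_e(j)` — for `e = id` the floor of the reversible Metropolis sampler
(`LevelSchemeCutCeiling.stFinCut_mixing_floor`). [ours] -/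
theorem stLiftCut_mixing_floor (hMst : ∀ k, IsStationary (μ k) (M k)) (j : Fin K) {n : ℕ}
    (hn : worstTvDist (fun p q : Fin (K + 1) × (S × Bool) =>
      t * stLiftLevel μ e p q + (1 - t) * stFinWithin (stLiftWithin M) p q) (stFinLaw (stLiftLaw μ)) n ≤ 1 / 4) :
    min ((((j : ℕ) : ℝ) + 1)) ((K : ℝ) - j) ≤ 2 * n * t * ∑ x, min (μ j.castSucc x) (μ j.succ (e j.castSucc x)) := by
  have hμ' := stLiftLaw_pos hμ
  have hμ1' := sum_stLiftLaw (μ := μ) hμ1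
  have hM' := stLiftWithin_isRowStochastic (M := M) hM
  have hMst' := stLiftWithin_isStationary (μ := μ) (M := M) hMst
  have hQ := stLiftLevel_isRowStochastic (e := e) hμ
  have hQst := stLiftLevel_isStationary (e := e) hμ
  have hK : (0 : ℝ) < K + 1 := by positivity
  have hflow : 4 * (n : ℝ) * (t * (K + 1) * edgeMeasure (stFinLaw (stLiftLaw μ)) (stLiftLevel μ e)
      (lowerLadder (S × Bool) j) (lowerLadder (S × Bool) j)ᶜ) = 2 * n * t * ∑ x, min (μ j.castSucc x) (μ j.succ (e j.castSucc x)) := by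
    rw [stLiftLevel_edgeMeasure_lowerLadder hμ]; field_simp; ring
  by_cases hj : 2 * ((j : ℕ) + 1) ≤ K + 1
  · have h := levelSchemeCut_mixing_floor_lower hμ' hμ1' hM' ht0 ht1 hQ hMst' hQst j hj hn
    exact (min_le_left _ _).trans (by rwa [hflow] at h)
  · have := j.isLt
    have h := levelSchemeCut_mixing_floor_upper hμ' hμ1' hM' ht0 ht1 hQ hMst' hQst j (by omega) hn
    exact (min_le_right _ _).trans (by rwa [hflow] at h)

/-- **THE BALLISTIC FLOOR OF THE LIFTED SAMPLER:** `d(n) ≤ ¼ ⇒ 3K ≤ 4n + 1`. [ours] -/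
theorem stLift_mixing_ballistic {n : ℕ}
    (hn : worstTvDist (fun p q : Fin (K + 1) × (S × Bool) =>
      t * stLiftLevel μ e p q + (1 - t) * stFinWithin (stLiftWithin M) p q) (stFinLaw (stLiftLaw μ)) n ≤ 1 / 4) :
    3 * K ≤ 4 * n + 1 :=
  levelScheme_mixing_ballistic (sum_stLiftLaw (μ := μ) hμ1) (stLiftWithin_isRowStochastic (M := M) hM) ht0 ht1
    (stLiftLevel_isRowStochastic (e := e) hμ) (fun _ _ h => stLiftLevel_rise_le_one h) hn

end Floors

end Summit.Ventures.LatticeQCDFlow.Scaling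

end
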